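import Summits.CriticalPhenomena.PercolationContinuityZ3.Theorems.Transplant.D4SKBits
import Summits.CriticalPhenomena.PercolationContinuityZ3.Theorems.Transplant.DiamondFilmSqShadowX
import HarnessLib

/-!
# Diamond film `D_4` certificate, III: THE INDEX ↔ VERTEX DICTIONARY — `vtx C z i`, its shadow and height, injectivity, adjacency, blocks, windows, columns

builds on p205010 (kernel theorem, internal audit signed; external expert review pending) — NOT used in this file.  Lane `prim-bschramm`, seat `prim-bschramm-p2` (gen 42; class C1b;
memo `HOME/bschramm/P2-LATTICES.md` §150); helper file (`--supports stmt-CriticalPhenomena-4575 --as helper`).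
«TriFilmSKGeo» for `D_4`: the vertex of `D_4` at a bit index of «D4SKDefs» over the centre `z` (the height is read off the parities of the column and the tag); for `z ≡ (c₀, c₁)
mod 2` and valid indices: the shadow is `z + (a − 5, b − 5)`, distinct indices give distinct vertices, `adjB` is adjacency of `D_4`, every vertex over `sqBall z 5` has an index,
and the block / window / centre / column tests read the corresponding sets of «SqShadowVRouteData(X)» at radius `4`.
[cite: ConwaySloane1999, Ch. 4 §7.3] [cite: DuminilCopinSidoraviciusTassion2016, §2.3 (proof of Fact 2)]
-/

noncomputable section

namespace Summit.CriticalPhenomena.PercolationContinuityZ3.Theorems.Transplant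

open Literature.Probability.Percolation Literature.Probability.LatticeModels SimpleGraph

namespace DiamondFilm.SK

open Slab111.SK (bitOf sdiff lowIdx maskBelow maskOfList endsOK orFold rd rdMask testBit_bitOf testBit_sdiff testBit_maskBelow of_testBit_maskBelow testBit_maskBelow_of)

variable {C : Ctx} {z : Site 2}

/-! ## §1 The vertex at an index -/

/-- The column of an index relative to the centre `z`. [folklore] -/
def relU (z : Site 2) (i : ℕ) : ℤ := z 0 + ((dA i : ℤ) - 5)
/-- The column of an index relative to the centre `z`. [folklore] -/
def relV (z : Site 2) (i : ℕ) : ℤ := z 1 + ((dB i : ℤ) - 5)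

/-- The height of the vertex at an index: read off the parities of its column and the tag (`4·t` over (even, even), else `1, 2, 3`). [cite: ConwaySloane1999, Ch. 4 §7.3] -/
def hgt (z : Site 2) (i : ℕ) : ℕ :=
  if relU z i % 2 = 0 then (if relV z i % 2 = 0 then 4 * min (dT i) 1 else 3) else (if relV z i % 2 = 0 then 1 else 2)

/-- `hgt ≤ 4`. [folklore] -/
theorem hgt_le (z : Site 2) (i : ℕ) : hgt z i ≤ 4 := by
  unfold hgt
  have := min_le_right (dT i) 1
  split_ifs <;> omega

/-- The height fits the column. [cite: ConwaySloane1999, Ch. 4 §7.3] -/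
theorem hgt_fits (z : Site 2) (i : ℕ) :
    (relU z i + relV z i) % 2 = ((hgt z i : ℕ) : ℤ) % 2 ∧ (relU z i - relV z i) % 2 = ((hgt z i : ℕ) : ℤ) % 2 ∧
      ((relU z i + relV z i + (relU z i - relV z i) + (hgt z i : ℕ)) % 4 = 0 ∨ (relU z i + relV z i + (relU z i - relV z i) + (hgt z i : ℕ)) % 4 = 3) := by
  unfold hgt
  have hm : min (dT i) 1 = 0 ∨ min (dT i) 1 = 1 := by have := min_le_right (dT i) 1; omega
  split_ifs with h1 h2 h3 <;> (try rcases hm with hm | hm) <;> (try rw [hm]) <;> refine ⟨by omega, by omega, by omega⟩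

/-- **The vertex of `D_4` at the index `i` over the centre `z`.** [cite: ConwaySloane1999, Ch. 4 §7.3] -/
def vtx (z : Site 2) (i : ℕ) : diamondFilm 4 :=
  mkV (relU z i + relV z i) (relU z i - relV z i) (hgt z i) (hgt_fits z i) (hgt_le z i)

/-- The shadow of `vtx`. [folklore] -/
theorem uv_vtx (z : Site 2) (i : ℕ) : uv (vtx z i) = ![relU z i, relV z i] := uv_mkV _ _ _ _ _

/-- First shadow coordinate. [folklore] -/
theorem sh_vtx_zero (z : Site 2) (i : ℕ) : uv (vtx z i) 0 = z 0 + ((dA i : ℤ) - 5) := by rw [uv_vtx]; rfl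
/-- Second shadow coordinate. [folklore] -/
theorem sh_vtx_one (z : Site 2) (i : ℕ) : uv (vtx z i) 1 = z 1 + ((dB i : ℤ) - 5) := by rw [uv_vtx]; rfl
/-- The height of `vtx`. [folklore] -/
theorem crd_vtx_two (z : Site 2) (i : ℕ) : crd (vtx z i) 2 = hgt z i := (crd_mkV _ _ _ _ _).2.2

/-- The centre class matches the centre. [folklore] -/
def CtrOK (C : Ctx) (z : Site 2) : Prop := z 0 % 2 = C.c0 ∧ z 1 % 2 = C.c1

/-- Under `CtrOK`, the (even, even) test reads the parities of the column. [folklore] -/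
theorem eeB_iff_par (hz : CtrOK C z) (i : ℕ) : C.eeB i = true ↔ relU z i % 2 = 0 ∧ relV z i % 2 = 0 := by
  rw [eeB_iff]; unfold relU relV dA dB; obtain ⟨h0, h1⟩ := hz; omega

/-- **The height of the vertex of a valid index, arithmetically** (with the tag and the column parities). [folklore] -/
theorem hgt_arith (hz : CtrOK C z) {i : ℕ} (hv : C.validB i = true) :
    dT i ≤ 1 ∧ ((hgt z i = 4 * dT i ∧ relU z i % 2 = 0 ∧ relV z i % 2 = 0) ∨ (hgt z i = 1 ∧ relU z i % 2 = 1 ∧ relV z i % 2 = 0 ∧ dT i = 0) ∨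
      (hgt z i = 2 ∧ relU z i % 2 = 1 ∧ relV z i % 2 = 1 ∧ dT i = 0) ∨ (hgt z i = 3 ∧ relU z i % 2 = 0 ∧ relV z i % 2 = 1 ∧ dT i = 0)) := by
  have hd := (validB_iff C i).1 hv
  have hee := eeB_iff_par hz i
  have ht : dT i = i / 144 := rfl
  have ht1 : dT i ≤ 1 := by rw [ht]; omega
  refine ⟨ht1, ?_⟩
  have htag : relU z i % 2 = 0 ∧ relV z i % 2 = 0 ∨ dT i = 0 := by
    rcases hd.2.2.2 with h | h
    · exact Or.inr (by rw [ht]; exact h)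
    · exact Or.inl (hee.1 h)
  have hu2 : relU z i % 2 = 0 ∨ relU z i % 2 = 1 := by omega
  have hv2 : relV z i % 2 = 0 ∨ relV z i % 2 = 1 := by omega
  unfold hgt
  rcases hu2 with hu | hu <;> rcases hv2 with hv' | hv'
  · left; rw [if_pos hu, if_pos hv']; refine ⟨?_, hu, hv'⟩; have : min (dT i) 1 = dT i := min_eq_left ht1; rw [this]
  · right; right; right; rw [if_pos hu, if_neg (by omega)]; exact ⟨rfl, hu, hv', by omega⟩
  · right; left; rw [if_neg (by omega), if_pos hv']; exact ⟨rfl, hu, hv', by omega⟩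
  · right; right; left; rw [if_neg (by omega), if_neg (by omega)]; exact ⟨rfl, hu, hv', by omega⟩

/-- `vcapB` arithmetically. [folklore] -/
theorem vcap_arith (hz : CtrOK C z) {i : ℕ} (hv : C.validB i = true) :
    C.vcapB i = true ↔ (relU z i % 2 = 0 ∧ relV z i % 2 = 0 ∧ dT i = 1) ∨ (¬ (relU z i % 2 = 0 ∧ relV z i % 2 = 0) ∧ dT i = 0) := by
  rw [vcapB_iff]
  have hee := eeB_iff_par hz i
  have ht : dT i = i / 144 := rfl
  constructor
  · rintro ⟨-, ⟨he, h1⟩ | ⟨he, h0⟩⟩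
    · exact Or.inl ⟨(hee.1 he).1, (hee.1 he).2, by rw [ht, h1]⟩
    · refine Or.inr ⟨fun h => ?_, by rw [ht, h0]⟩
      have := hee.2 h; rw [he] at this; exact Bool.noConfusion this
  · rintro (⟨hu, hv', h1⟩ | ⟨hne, h0⟩)
    · exact ⟨hv, Or.inl ⟨hee.2 ⟨hu, hv'⟩, by rw [← ht]; exact h1⟩⟩
    · refine ⟨hv, Or.inr ⟨?_, by rw [← ht]; exact h0⟩⟩
      cases h : C.eeB i
      · rfl
      · exact absurd (hee.1 h) hne

/-- Unfolding the relative columns. [folklore] -/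
theorem rel_eq (z : Site 2) (i : ℕ) : relU z i = z 0 + ((dA i : ℤ) - 5) ∧ relV z i = z 1 + ((dB i : ℤ) - 5) := ⟨rfl, rfl⟩

/-- Digits in arithmetic form. [folklore] -/
theorem digit_eq (i : ℕ) : dA i = (i % 144) / 12 ∧ dB i = i % 12 ∧ dT i = i / 144 := ⟨rfl, rfl, rfl⟩

/-- **Distinct valid indices give distinct vertices.** [folklore] -/
theorem vtx_inj (hz : CtrOK C z) {i j : ℕ} (hi : C.validB i = true) (hj : C.validB j = true) (h : vtx z i = vtx z j) : i = j := by
  have hu := congrArg (fun x => uv x 0) h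
  have hv := congrArg (fun x => uv x 1) h
  have hh := congrArg (fun x => crd x 2) h
  simp only [sh_vtx_zero, sh_vtx_one, crd_vtx_two] at hu hv hh
  have hdi := (validB_iff C i).1 hi
  have hdj := (validB_iff C j).1 hj
  obtain ⟨ti1, gi⟩ := hgt_arith hz hi
  obtain ⟨tj1, gj⟩ := hgt_arith hz hj
  obtain ⟨ui, vi⟩ := rel_eq z i
  obtain ⟨uj, vj⟩ := rel_eq z j
  obtain ⟨ai, bi, ti⟩ := digit_eq i
  obtain ⟨aj, bj, tj⟩ := digit_eq j
  have hdi' := digits C i hi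
  have hdj' := digits C j hj
  clear hdi hdj h
  have ha : dA i = dA j := by omega
  have hb : dB i = dB j := by omega
  have ht : dT i = dT j := by
    rcases gi with ⟨g1, u1, v1⟩ | ⟨g1, u1, v1, t1⟩ | ⟨g1, u1, v1, t1⟩ | ⟨g1, u1, v1, t1⟩ <;>
      rcases gj with ⟨g2, u2, v2⟩ | ⟨g2, u2, v2, t2⟩ | ⟨g2, u2, v2, t2⟩ | ⟨g2, u2, v2, t2⟩ <;> omega
  omega

/-! ## §2 Adjacency -/

/-- Coordinates of `vtx`. [folklore] -/
theorem crd_vtx (z : Site 2) (i : ℕ) : crd (vtx z i) 0 = relU z i + relV z i ∧ crd (vtx z i) 1 = relU z i - relV z i ∧ crd (vtx z i) 2 = hgt z i := crd_mkV _ _ _ _ _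

/-- **Adjacent valid indices are adjacent vertices of `D_4`.** [cite: ConwaySloane1999, Ch. 4 §7.3] -/
theorem adj_vtx (hz : CtrOK C z) {i j : ℕ} (hi : C.validB i = true) (hj : C.validB j = true) (h : C.adjB i j = true) :
    (diamondGraph.induce (diamondFilm 4)).Adj (vtx z i) (vtx z j) := by
  rw [adj_crd_iff]
  obtain ⟨a0, a1, a2⟩ := crd_vtx z i
  obtain ⟨b0, b1, b2⟩ := crd_vtx z j
  rw [a0, a1, a2, b0, b1, b2]
  obtain ⟨ui, vi⟩ := rel_eq z i
  obtain ⟨uj, vj⟩ := rel_eq z j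
  obtain ⟨ai, bi, ti⟩ := digit_eq i
  obtain ⟨aj, bj, tj⟩ := digit_eq j
  obtain ⟨ti1, gi⟩ := hgt_arith hz hi
  obtain ⟨tj1, gj⟩ := hgt_arith hz hj
  have ci := vcap_arith hz hi
  have cj := vcap_arith hz hj
  rw [adjB_iff'] at h
  obtain ⟨-, -, h⟩ := h
  have hdi := digits C i hi
  have hdj := digits C j hj
  rcases h with ⟨hti, htj, hb, ha⟩ | ⟨ha, hb, hci, hcj⟩
  · refine ⟨by omega, by omega, ?_⟩
    rcases gi with ⟨g1, u1, v1⟩ | ⟨g1, u1, v1, t1⟩ | ⟨g1, u1, v1, t1⟩ | ⟨g1, u1, v1, t1⟩ <;>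
      rcases gj with ⟨g2, u2, v2⟩ | ⟨g2, u2, v2, t2⟩ | ⟨g2, u2, v2, t2⟩ | ⟨g2, u2, v2, t2⟩ <;> omega
  · have ci' := ci.1 hci
    have cj' := cj.1 hcj
    clear ci cj
    refine ⟨by omega, by omega, ?_⟩
    rcases gi with ⟨g1, u1, v1⟩ | ⟨g1, u1, v1, t1⟩ | ⟨g1, u1, v1, t1⟩ | ⟨g1, u1, v1, t1⟩ <;>
      rcases gj with ⟨g2, u2, v2⟩ | ⟨g2, u2, v2, t2⟩ | ⟨g2, u2, v2, t2⟩ | ⟨g2, u2, v2, t2⟩ <;> omega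

/-- **Adjacent vertices of valid indices have adjacent indices.** [cite: ConwaySloane1999, Ch. 4 §7.3] -/
theorem adjB_of_adj (hz : CtrOK C z) {i j : ℕ} (hi : C.validB i = true) (hj : C.validB j = true)
    (h : (diamondGraph.induce (diamondFilm 4)).Adj (vtx z i) (vtx z j)) : C.adjB i j = true := by
  rw [adj_crd_iff] at h
  obtain ⟨a0, a1, a2⟩ := crd_vtx z i
  obtain ⟨b0, b1, b2⟩ := crd_vtx z j
  rw [a0, a1, a2, b0, b1, b2] at h
  obtain ⟨ui, vi⟩ := rel_eq z i
  obtain ⟨uj, vj⟩ := rel_eq z j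
  obtain ⟨ai, bi, ti⟩ := digit_eq i
  obtain ⟨aj, bj, tj⟩ := digit_eq j
  obtain ⟨ti1, gi⟩ := hgt_arith hz hi
  obtain ⟨tj1, gj⟩ := hgt_arith hz hj
  have ci := vcap_arith hz hi
  have cj := vcap_arith hz hj
  have hdi := digits C i hi
  have hdj := digits C j hj
  rw [adjB_iff']
  refine ⟨hi, hj, ?_⟩
  obtain ⟨h0, h1, h2⟩ := h
  by_cases hh : dB i = dB j
  · -- horizontal
    left
    rcases gi with ⟨g1, u1, v1⟩ | ⟨g1, u1, v1, t1⟩ | ⟨g1, u1, v1, t1⟩ | ⟨g1, u1, v1, t1⟩ <;>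
      rcases gj with ⟨g2, u2, v2⟩ | ⟨g2, u2, v2, t2⟩ | ⟨g2, u2, v2, t2⟩ | ⟨g2, u2, v2, t2⟩ <;> omega
  · -- vertical
    right
    refine ⟨by omega, by omega, ci.2 ?_, cj.2 ?_⟩
    · rcases gi with ⟨g1, u1, v1⟩ | ⟨g1, u1, v1, t1⟩ | ⟨g1, u1, v1, t1⟩ | ⟨g1, u1, v1, t1⟩ <;>
        rcases gj with ⟨g2, u2, v2⟩ | ⟨g2, u2, v2, t2⟩ | ⟨g2, u2, v2, t2⟩ | ⟨g2, u2, v2, t2⟩ <;>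
        first | exact Or.inr ⟨by omega, by omega⟩ | exact Or.inl ⟨by omega, by omega, by omega⟩
    · rcases gi with ⟨g1, u1, v1⟩ | ⟨g1, u1, v1, t1⟩ | ⟨g1, u1, v1, t1⟩ | ⟨g1, u1, v1, t1⟩ <;>
        rcases gj with ⟨g2, u2, v2⟩ | ⟨g2, u2, v2, t2⟩ | ⟨g2, u2, v2, t2⟩ | ⟨g2, u2, v2, t2⟩ <;>
        first | exact Or.inr ⟨by omega, by omega⟩ | exact Or.inl ⟨by omega, by omega, by omega⟩

/-- **Every vertex of `D_4` over `sqBall z 5` has a valid index.** [folklore] -/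
theorem exists_idx (hz : CtrOK C z) (x : diamondFilm 4) (hx : uv x ∈ sqBall z 5) : ∃ i, C.validB i = true ∧ vtx z i = x := by
  rw [mem_sqBall_iff_linear] at hx
  obtain ⟨p0, p1, p2, h3, h4⟩ := crd_facts x
  obtain ⟨e0, e1⟩ := crd_eq_of_uv x
  obtain ⟨A, hA⟩ := Int.eq_ofNat_of_zero_le (show (0 : ℤ) ≤ uv x 0 - z 0 + 5 by push_cast at hx; omega)
  obtain ⟨B, hB⟩ := Int.eq_ofNat_of_zero_le (show (0 : ℤ) ≤ uv x 1 - z 1 + 5 by push_cast at hx; omega)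
  obtain ⟨H, hH⟩ := Int.eq_ofNat_of_zero_le h3
  set t : ℕ := if H = 4 then 1 else 0 with htdef
  have ht : (H = 4 ∧ t = 1) ∨ (H ≠ 4 ∧ t = 0) := by rw [htdef]; split_ifs with h <;> simp [h]
  set i : ℕ := 144 * t + 12 * A + B with hidef
  have hA10 : A ≤ 10 := by push_cast at hx; omega
  have hB10 : B ≤ 10 := by push_cast at hx; omega
  have hdA : dA i = A := by unfold dA; omega
  have hdB : dB i = B := by unfold dB; omega
  have hdT : dT i = t := by unfold dT; omega
  have hU : relU z i = uv x 0 := by unfold relU; rw [hdA]; omega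
  have hV : relV z i = uv x 1 := by unfold relV; rw [hdB]; omega
  -- the parities of the column from the diamond arithmetic of `x`
  rw [e0, e1] at p2; rw [e0] at p0
  have hee := eeB_iff_par hz i
  rw [hU, hV] at hee
  have hv : C.validB i = true := by
    rw [validB_iff]
    refine ⟨by omega, by rw [← (digit_eq i).1, hdA]; exact hA10, by rw [← (digit_eq i).2.1, hdB]; exact hB10, ?_⟩
    rcases ht with ⟨hH4, ht1⟩ | ⟨hH4, ht0⟩
    · right; apply hee.2; omega
    · left; rw [← (digit_eq i).2.2, hdT, ht0]
  refine ⟨i, hv, ?_⟩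
  apply ext_crd; intro s
  obtain ⟨c0, c1, c2⟩ := crd_vtx z i
  obtain ⟨-, gi⟩ := hgt_arith hz hv
  rw [hU, hV, hdT] at gi
  fin_cases s
  · show crd (vtx z i) 0 = crd x 0; rw [c0, hU, hV, e0]
  · show crd (vtx z i) 1 = crd x 1; rw [c1, hU, hV, e1]
  · show crd (vtx z i) 2 = crd x 2
    rw [c2, hH]
    rw [hH] at p2 p0 p1 h4
    clear c0 c1 c2 hee hv e0 e1
    rcases gi with ⟨g1, u1, v1⟩ | ⟨g1, u1, v1, t1⟩ | ⟨g1, u1, v1, t1⟩ | ⟨g1, u1, v1, t1⟩ <;> omega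

/-- **A neighbour of the vertex of an index over `sqBall z 4` has a valid index, adjacent in `adjB`.** [folklore] -/
theorem exists_idx_of_adj (hz : CtrOK C z) {i : ℕ} (hi : C.validB i = true) (h4 : uv (vtx z i) ∈ sqBall z 4)
    {y : diamondFilm 4} (h : (diamondGraph.induce (diamondFilm 4)).Adj (vtx z i) y) : ∃ j, C.validB j = true ∧ vtx z j = y ∧ C.adjB i j = true := by
  have hy : uv y ∈ sqBall z 5 := by
    have hs := uv_step h
    rw [mem_sqBall_iff_linear] at h4 ⊢
    rcases hs with ⟨h0, h1⟩ | ⟨h0, h1⟩ <;> push_cast at h4 ⊢ <;> omega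
  obtain ⟨j, hj, rfl⟩ := exists_idx hz y hy
  exact ⟨j, hj, rfl, adjB_of_adj hz hi hj h⟩

/-! ## §3 Reading the block, window, centre and column tests -/

/-- The shadow of an index lies in `sqBall z n` iff its digits do. [folklore] -/
theorem sqBall_vtx_iff (z : Site 2) (i n : ℕ) : uv (vtx z i) ∈ sqBall z n ↔ dA i ≤ n + 5 ∧ 5 ≤ dA i + n ∧ dB i ≤ n + 5 ∧ 5 ≤ dB i + n := by
  rw [mem_sqBall_iff_linear, sh_vtx_zero, sh_vtx_one]; omega

/-- **The rerouting-block test reads membership in `sqBlkR 4 z tR sR`.** [folklore] -/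
theorem inRB_iff_mem_blkR {i : ℕ} (hv : C.validB i = true) {tR sR : ℕ} (htR : C.tR = min tR 4) (hsR : min C.sR 4 = min sR 4) :
    C.inRB i = true ↔ uv (vtx z i) ∈ sqBlkR 4 z tR sR := by
  rw [mem_sqBlkR, sqBall_vtx_iff, sh_vtx_zero, sh_vtx_one]
  simp only [Ctx.inRB, Ctx.inBlkB, hv, Bool.true_and, Bool.and_eq_true, decide_eq_true_eq, htR, hsR]
  omega

/-- Membership in the cleared block `sqBlkR 4 z tD sD` from the cleared-block test. [folklore] -/
theorem mem_blkR_of_inDB {i : ℕ} {tD sD : ℕ} (htD : min C.tD 4 = min tD 4) (hsD : min C.sD 4 = min sD 4) (h : C.inDB i = true) :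
    uv (vtx z i) ∈ sqBlkR 4 z tD sD := by
  rw [mem_sqBlkR, sqBall_vtx_iff, sh_vtx_zero, sh_vtx_one]
  simp only [Ctx.inDB, Ctx.inBlkB, Bool.and_eq_true, decide_eq_true_eq] at h
  omega

/-- The cleared-block test from membership in `sqBall z 1 ∩ sqBlkR 4 z tD sD` (the forced core). [folklore] -/
theorem core_of_mem {i : ℕ} (hv : C.validB i = true) {tD sD : ℕ} (htD : min C.tD 4 = min tD 4) (hsD : min C.sD 4 = min sD 4)
    (h1 : uv (vtx z i) ∈ sqBall z 1) (hD : uv (vtx z i) ∈ sqBlkR 4 z tD sD) :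
    C.inDB i = true ∧ 4 ≤ dA i ∧ dA i ≤ 6 ∧ 4 ≤ dB i ∧ dB i ≤ 6 := by
  rw [sqBall_vtx_iff] at h1
  rw [mem_sqBlkR, sqBall_vtx_iff, sh_vtx_zero, sh_vtx_one] at hD
  simp only [Ctx.inDB, Ctx.inBlkB, hv, Bool.true_and, Bool.and_eq_true, decide_eq_true_eq]
  omega

/-- **The `γ`-window test from the real window** (the case window at least the real one). [folklore] -/
theorem inWinB_of_inWin {i : ℕ} (hv : C.validB i = true) {tD sR : ℕ} (hwT : tD ≤ C.tD ∨ 5 ≤ C.tD) (hwS : sR ≤ C.sR ∨ 5 ≤ C.sR)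
    (h : SqShadow.InWin z tD sR (uv (vtx z i))) : C.inWinB i = true := by
  unfold SqShadow.InWin at h
  rw [sh_vtx_zero, sh_vtx_one] at h
  have hv' := (validB_iff C i).1 hv
  obtain ⟨ai, bi, -⟩ := digit_eq i
  simp only [Ctx.inWinB, hv, Bool.true_and, Bool.and_eq_true, decide_eq_true_eq]
  omega

/-- **The exit-window test from the real exit window.** [folklore] -/
theorem inWinDB_of_inWin {i : ℕ} (hv : C.validB i = true) {tD sD : ℕ} (hwT : tD ≤ C.tD ∨ 5 ≤ C.tD) (hwS : sD ≤ C.sD ∨ 5 ≤ C.sD)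
    (h : SqShadow.InWin z tD sD (uv (vtx z i))) : C.inWinDB i = true := by
  unfold SqShadow.InWin at h
  rw [sh_vtx_zero, sh_vtx_one] at h
  have hv' := (validB_iff C i).1 hv
  obtain ⟨ai, bi, -⟩ := digit_eq i
  simp only [Ctx.inWinDB, hv, Bool.true_and, Bool.and_eq_true, decide_eq_true_eq]
  omega

/-- **The centre test reads "over `z`".** [folklore] -/
theorem cenB_iff {i : ℕ} (hv : C.validB i = true) : C.cenB i = true ↔ uv (vtx z i) = z := by
  simp only [Ctx.cenB, hv, Bool.true_and, Bool.and_eq_true, beq_iff_eq]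
  rw [uv_vtx]
  obtain ⟨ui, vi⟩ := rel_eq z i
  constructor
  · rintro ⟨ha, hb⟩; ext t; fin_cases t
    · show relU z i = z 0; rw [ui, ha]; simp
    · show relV z i = z 1; rw [vi, hb]; simp
  · intro h
    have h0 : relU z i = z 0 := congrFun h 0
    have h1 : relV z i = z 1 := congrFun h 1
    omega

/-- Two indices lie over the same column iff their column codes agree. [folklore] -/
theorem sh_eq_iff_mod (i j : ℕ) : uv (vtx z i) = uv (vtx z j) ↔ i % 144 = j % 144 := by
  rw [uv_vtx, uv_vtx]
  obtain ⟨ui, vi⟩ := rel_eq z i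
  obtain ⟨uj, vj⟩ := rel_eq z j
  obtain ⟨ai, bi, -⟩ := digit_eq i
  obtain ⟨aj, bj, -⟩ := digit_eq j
  constructor
  · intro h
    have h0 : relU z i = relU z j := congrFun h 0
    have h1 : relV z i = relV z j := congrFun h 1
    omega
  · intro h; ext t; fin_cases t
    · show relU z i = relU z j; omega
    · show relV z i = relV z j; omega

/-- **Bits of a column mask**: the valid indices with the same column code. [folklore] -/
theorem testBit_colM_iff (C : Ctx) (e i : ℕ) : (C.colM e).testBit i = true ↔ C.validB i = true ∧ i % 144 = e % 144 := by
  unfold Ctx.colM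
  rw [Nat.testBit_land, Bool.and_eq_true, Nat.testBit_lor, Bool.or_eq_true, testBit_bitOf, testBit_bitOf, decide_eq_true_eq, decide_eq_true_eq, Ctx.univ,
    testBit_maskBelow, Bool.and_eq_true, decide_eq_true_eq]
  constructor
  · rintro ⟨h | h, hi, hv⟩ <;> exact ⟨hv, by omega⟩
  · rintro ⟨hv, hmod⟩
    have hi := ((validB_iff C i).1 hv).1
    refine ⟨by omega, hi, hv⟩

/-- Column mask membership reads equality of shadows. [folklore] -/
theorem testBit_colM_iff_sh {e i : ℕ} (hi : C.validB i = true) : (C.colM e).testBit i = true ↔ uv (vtx z i) = uv (vtx z e) := by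
  rw [testBit_colM_iff, sh_eq_iff_mod]
  exact ⟨fun h => h.2, fun h => ⟨hi, h⟩⟩

end DiamondFilm.SK

end Summit.CriticalPhenomena.PercolationContinuityZ3.Theorems.Transplant

end
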